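import Mathlib
import Summits.HodgeConjecture.HodgeConjecture.Theorems.HodgeLocusCensusUnitColumnRank
import Summits.HodgeConjecture.HodgeConjecture.Theorems.HodgeLocusCensusUnitColumnRankD4

/-!
# HodgeLocus census — THEOREM K-MODEL, the `d = 3` cells: `×ℓ^{c′}` on the Boolean model `K[x₁,…,x_k]/(x_i²)` (ENGINE B, B46-R‴)

certified instances and evidence bearing on the general Hodge conjecture; no claim.

SETTING (record `ENGINEB-g31.md` §11a, case (3)).  In a cell `(n, 3, m)` the model member has `B = K[x₁,…,x_k]/(x₁²,…,x_k²)` (`k = k′ = m + 1`, socle degree `k`),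
`δ = ℓ^{c′}`, `ℓ = x₁ + ⋯ + x_k` (`c′ = n/2 − m`), and `ρ = rank (×ℓ^{c′} : B_{k−3} → B_{k+c′−3})`.  The record asserts MAXIMAL RANK `ρ = min (C(k,3), C(k,3−c′))`, citing
Stanley's strong-Lefschetz theorem (characteristic `0`, paper proof).  This sheet certifies every such cell — `c′ = 1, 2, 3` and every `k ≥ 3`; for `c′ ≥ 4` or `k ≤ 2`
a side is `0`-dimensional — by elementary span identities, over every field in which the integers named in the statement are units (sharp: NECESSITY below).

INDEX CONVENTION (anchors 172/174, at `d = 3`).  A monomial of `B` is a squarefree exponent function `v : Fin k → Fin 2`; `B_{k−j}` is indexed by `{v // Σ v_i + j = k·1}`,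
the functions whose ZERO SET has `j` elements (`card_filter_eq`; `dim B_{k−j} = C(k,j)`, `card_level`; `dim B_k = 1`, `card_top_eq_one`).  The matrix of `×ℓ` has entry
`[List.ofFn v ∈ colR 3 (List.ofFn m)]` (`colR 3`, gen 31, lists the monomials of `ℓ·x^m`: one zero exponent raised to `1 = d − 2`), that of `×ℓ²` the multiplicity of
`List.ofFn v` in `(colR 3 (List.ofFn m)).flatMap (colR 3)` (the coefficient of `x^v` in `ℓ·(ℓ·x^m)`), that of `×ℓ³` one `flatMap` more — as in THEOREMS (i)–(iii) of anchor
174 (`d = 4`); rows = target monomials, columns = source monomials.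

THEOREMS (kernel `Matrix.rank` statements; `K` a field).
 (i)   `c′ = 1`:  `rank_mulL_modelC1_d3` — `k ≥ 5`, `2, 3` units: rank `= card rows = C(k,2)` (`×ℓ : B_{k−3} → B_{k−2}` onto);  `rank_mulL_modelC1_d3_four` — `k = 4`,
       `2` a unit: rank `= card cols = 4` (into; `6 × 4`);  `rank_mulL_modelC1_d3_three` — `k = 3`, every field: rank `= card cols = 1`.
 (ii)  `c′ = 2`:  `rank_mulL2_modelC1_d3` — `k ≥ 4`, `2, 3` units: rank `= card rows = k` (`×ℓ² : B_{k−3} → B_{k−1}` onto);  `rank_mulL2_modelC1_d3_three` — `k = 3`, `2` a unit: `= 1`.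
 (iii) `c′ = 3`:  `rank_mulL3_modelC1_d3` — `k ≥ 3`, `2, 3` units: rank `= 1 = dim B_k` (`×ℓ³ : B_{k−3} → B_k` onto the socle line).

METHOD (no Lefschetz theory; LAYER A of anchor 168, LAYER A′ + the `colR` bridge of anchor 174).  On squarefree monomials `×ℓ^{c}` is `c!` times the INCLUSION matrix of
zero sets: the column at the source with zero set `{a,b,c}` is `χ_{bc} + χ_{ac} + χ_{ab}` for `×ℓ` (`col_one_eq`) and `2(χ_a + χ_b + χ_c)` for `×ℓ²` (`col_two_eq`), `χ_P` the
indicator of the target with zero set `P` (`mem_colR_ind_iff`: the members of `colR 3 (ofFn 𝟙_S)` are the `ofFn 𝟙_{S ∖ i}`, `i ∈ S`).  `c′ = 1, k ≥ 5`: in a 5-set `{a,…,e}`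
the ten triple columns invert over `ℤ[1/6]`, `6·χ_{ab} = 2(col_{abc} + col_{abd} + col_{abe}) − (col_{acd} + col_{ace} + col_{ade} + col_{bcd} + col_{bce} + col_{bde}) +
2·col_{cde}` (`mem_of_ten_triples`, tactic `module`), so every unit row vector is in the column span (`rank_eq_card_of_single_mem_span_cols`);  `c′ = 2, k ≥ 4`:
`6·χ_d = col_{abd} + col_{acd} + col_{bcd} − 2·col_{abc}` (`mem_of_four_triples`).  The other cells are one nonzero minor against the trivial bound
(`card_le_rank_of_det_ne_zero`): `1 × 1` minors `1`, `2`, `6 = 3!` (`count_flatMap3`), and for (i) at `k = 4` the `4 × 4` minor `det = 2` of the `6 × 4` matrix — the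
literal cells `k = 3, 4` carry the only kernel `decide`s (entries, masses, `Fin.succAbove 1 2 = 3`), as the `k = 2` cell of anchor 174 does.
NECESSITY (evidence, not theorems: exact ranks by the second implementation `check_d3.py`, `k = 3..12`).  Over `GF(2)` / `GF(3)`: (i) `k ≥ 5`: `C(k,2) − k + 1` / `C(k,2) − 1`;
(i) `k = 4`: `3` / `4`; (ii) `k ≥ 4`: `0` / `k − 1`; (ii) `k = 3`: `0` / `1`; (iii): `0` / `0` (`ℓ³ = 6·e₃(x)`).  So each stated hypothesis is needed.
SCOPE (said plainly).  Statements about explicit matrices read off gen 31's `colR`; that these ranks are the `ρ` of THEOREM K⁼ / K-MODEL is the record's step (outside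
Lean, as in the anchors).  Evidence-class upgrade (and a sharpening: `6` a unit, not characteristic `0`) of a record statement; no census number changes; nothing about HC.
-/

set_option linter.dupNamespace false
set_option autoImplicit false

namespace Summit.HodgeConjecture.HodgeConjecture.HodgeLocus.Census.UnitColumnRankD3

open Summit.HodgeConjecture.HodgeConjecture.HodgeLocus.Census.ModelNonJumpC1All (colR colR_pos)
open Summit.HodgeConjecture.HodgeConjecture.HodgeLocus.Census.UnitColumnRank (card_le_rank_of_det_ne_zero)
open Summit.HodgeConjecture.HodgeConjecture.HodgeLocus.Census.UnitColumnRankD4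
  (rank_eq_card_of_single_mem_span_cols mem_colR_iff colR_nodup indicator_eq_count_colR)

/-! ## LAYER A″ — two inversion identities over `ℤ[1/6]` -/

/-- `6` is a unit when `2` and `3` are -/
theorem six_ne_zero_of {K : Type*} [Field K] (h2 : (2 : K) ≠ 0) (h3 : (3 : K) ≠ 0) : (6 : K) ≠ 0 := by
  rw [show (6 : K) = 2 * 3 by norm_num]; exact mul_ne_zero h2 h3

/-- `W₂₃` of a 5-set `{a,b,c,d,e}` is invertible over `ℤ[1/6]`: the pair `ab` from the ten triple columns (`xyz ↦ yz + xz + xy`). -/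
theorem mem_of_ten_triples {K M : Type*} [Field K] [AddCommGroup M] [Module K M] (h2 : (2 : K) ≠ 0) (h3 : (3 : K) ≠ 0) (S : Submodule K M)
    {ab ac ad ae bc bd be cd ce de : M} (habc : bc + ac + ab ∈ S) (habd : bd + ad + ab ∈ S) (habe : be + ae + ab ∈ S) (hacd : cd + ad + ac ∈ S)
    (hace : ce + ae + ac ∈ S) (hade : de + ae + ad ∈ S) (hbcd : cd + bd + bc ∈ S) (hbce : ce + be + bc ∈ S) (hbde : de + be + bd ∈ S)
    (hcde : de + ce + cd ∈ S) : ab ∈ S := by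
  have key : (6 : K) • ab = (2 : K) • ((bc + ac + ab) + (bd + ad + ab) + (be + ae + ab))
      - ((cd + ad + ac) + (ce + ae + ac) + (de + ae + ad) + (cd + bd + bc) + (ce + be + bc) + (de + be + bd)) + (2 : K) • (de + ce + cd) := by module
  refine (Submodule.smul_mem_iff S (six_ne_zero_of h2 h3)).mp ?_; rw [key]
  exact S.add_mem (S.sub_mem (S.smul_mem _ (S.add_mem (S.add_mem habc habd) habe))
    (S.add_mem (S.add_mem (S.add_mem (S.add_mem (S.add_mem hacd hace) hade) hbcd) hbce) hbde)) (S.smul_mem _ hcde)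

/-- `2·W₁₃` of a 4-set `{a,b,c,d}` is invertible over `ℤ[1/6]`: the point `d` from the four triple columns (`xyz ↦ 2(x + y + z)`). -/
theorem mem_of_four_triples {K M : Type*} [Field K] [AddCommGroup M] [Module K M] (h2 : (2 : K) ≠ 0) (h3 : (3 : K) ≠ 0) (S : Submodule K M) {a b c d : M}
    (habc : (2 : K) • (a + b + c) ∈ S) (habd : (2 : K) • (a + b + d) ∈ S) (hacd : (2 : K) • (a + c + d) ∈ S) (hbcd : (2 : K) • (b + c + d) ∈ S) :
    d ∈ S := by
  have key : (6 : K) • d = (2 : K) • (a + b + d) + (2 : K) • (a + c + d) + (2 : K) • (b + c + d) - (2 : K) • ((2 : K) • (a + b + c)) := by module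
  refine (Submodule.smul_mem_iff S (six_ne_zero_of h2 h3)).mp ?_; rw [key]
  exact S.sub_mem (S.add_mem (S.add_mem habd hacd) hbcd) (S.smul_mem _ habc)

/-- the indicator of a disjoint disjunction is the sum of the indicators (two terms) … -/
theorem ite_or_two {K : Type*} [Field K] {P Q : Prop} [Decidable P] [Decidable Q] [Decidable (P ∨ Q)] (hPQ : ¬(P ∧ Q)) :
    (if P ∨ Q then (1 : K) else 0) = (if P then 1 else 0) + (if Q then 1 else 0) := by
  by_cases hp : P <;> by_cases hq : Q <;> simp_all

/-- … (three terms) -/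
theorem ite_or_three {K : Type*} [Field K] {P Q R : Prop} [Decidable P] [Decidable Q] [Decidable R] [Decidable (P ∨ Q ∨ R)] (hPQ : ¬(P ∧ Q)) (hPR : ¬(P ∧ R))
    (hQR : ¬(Q ∧ R)) : (if P ∨ Q ∨ R then (1 : K) else 0) = (if P then 1 else 0) + (if Q then 1 else 0) + (if R then 1 else 0) := by
  by_cases hp : P <;> by_cases hq : Q <;> by_cases hr : R <;> simp_all

/-! ## Two-level exponent functions `Fin k → Fin 2` and their zero sets -/

/-- mass plus the number of zero exponents is `k` -/
theorem sum_add_card_filter {k : ℕ} (v : Fin k → Fin 2) : (∑ i, (v i : ℕ)) + (Finset.univ.filter (fun l => v l = 0)).card = k * 1 := by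
  have h2 : ∀ l : Fin k, (v l : ℕ) + (if v l = 0 then 1 else 0) = 1 := fun l => by
    have hl := (v l).2
    by_cases h : v l = 0
    · simp [h]
    · have h1 : (v l : ℕ) ≠ 0 := fun e => h (Fin.ext e); rw [if_neg h]; omega
  have h3 := Finset.sum_congr rfl (fun l (_ : l ∈ Finset.univ) => h2 l)
  rw [Finset.sum_add_distrib, Finset.sum_boole] at h3
  simp only [Nat.cast_id, Finset.sum_const, smul_eq_mul, Finset.card_univ, Fintype.card_fin] at h3
  omega

/-- a two-level exponent function is the indicator `𝟙_S := (l ↦ if l ∈ S then 0 else 1)` of its zero set `S` … -/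
theorem eq_ind_filter {k : ℕ} (v : Fin k → Fin 2) : v = fun l => if l ∈ Finset.univ.filter (fun l => v l = 0) then (0 : Fin 2) else 1 := by
  funext l
  by_cases h : v l = 0
  · simp [h]
  · have hl := (v l).2; have h1 : (v l : ℕ) ≠ 0 := fun e => h (Fin.ext e)
    simp only [Finset.mem_filter, Finset.mem_univ, true_and, if_neg h]; exact Fin.ext (by simp only [Fin.val_one]; omega)

/-- … which has `j` elements on `B_{k−j}` -/
theorem card_filter_eq {k j : ℕ} (v : Fin k → Fin 2) (hv : (∑ i, (v i : ℕ)) + j = k * 1) : (Finset.univ.filter (fun l => v l = 0)).card = j := by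
  have h := sum_add_card_filter v
  omega

/-- the mass of `𝟙_S` -/
theorem sum_ind {k : ℕ} (S : Finset (Fin k)) : (∑ l : Fin k, ((if l ∈ S then (0 : Fin 2) else 1 : Fin 2) : ℕ)) + S.card = k * 1 := by
  have h := sum_add_card_filter (fun l => if l ∈ S then (0 : Fin 2) else 1)
  have hS : Finset.univ.filter (fun l => (if l ∈ S then (0 : Fin 2) else 1) = 0) = S := by ext l; by_cases hl : l ∈ S <;> simp [hl]
  rwa [hS] at h

/-- the mass of `𝟙_{abc}` -/
theorem sum_ind_three {k : ℕ} (a b c : Fin k) (hab : a ≠ b) (hac : a ≠ c) (hbc : b ≠ c) :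
    (∑ l : Fin k, ((if l ∈ ({a, b, c} : Finset (Fin k)) then (0 : Fin 2) else 1 : Fin 2) : ℕ)) + 3 = k * 1 := by
  have h := sum_ind ({a, b, c} : Finset (Fin k))
  rwa [Finset.card_eq_three.mpr ⟨a, b, c, hab, hac, hbc, rfl⟩] at h

/-- the monomials of `B_{k−1}`: one zero exponent -/
theorem row_shape_one {k : ℕ} (v : Fin k → Fin 2) (hv : (∑ i, (v i : ℕ)) + 1 = k * 1) :
    ∃ a : Fin k, v = fun l => if l ∈ ({a} : Finset (Fin k)) then (0 : Fin 2) else 1 := by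
  obtain ⟨a, h⟩ := Finset.card_eq_one.mp (card_filter_eq v hv)
  exact ⟨a, (eq_ind_filter v).trans (by rw [h])⟩

/-- the monomials of `B_{k−2}`: two zero exponents -/
theorem row_shape_two {k : ℕ} (v : Fin k → Fin 2) (hv : (∑ i, (v i : ℕ)) + 2 = k * 1) :
    ∃ a b : Fin k, a ≠ b ∧ v = fun l => if l ∈ ({a, b} : Finset (Fin k)) then (0 : Fin 2) else 1 := by
  obtain ⟨a, b, hab, h⟩ := Finset.card_eq_two.mp (card_filter_eq v hv)
  exact ⟨a, b, hab, (eq_ind_filter v).trans (by rw [h])⟩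

/-- `dim B_{k−j} = C(k, j)`: exponent functions of mass `k − j` ↔ their `j`-element zero sets -/
theorem card_level (k j : ℕ) : Fintype.card {v : Fin k → Fin 2 // (∑ i, (v i : ℕ)) + j = k * 1} = k.choose j := by
  have e : {v : Fin k → Fin 2 // (∑ i, (v i : ℕ)) + j = k * 1} ≃ {s : Finset (Fin k) // s.card = j} :=
    { toFun := fun v => ⟨Finset.univ.filter (fun l => v.1 l = 0), card_filter_eq v.1 v.2⟩
      invFun := fun s => ⟨fun l => if l ∈ s.1 then 0 else 1, by have h := sum_ind s.1; rw [s.2] at h; exact h⟩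
      left_inv := fun v => Subtype.ext (eq_ind_filter v.1).symm
      right_inv := fun s => Subtype.ext (by ext l; by_cases hl : l ∈ s.1 <;> simp [hl]) }
  rw [Fintype.card_congr e, Fintype.card_finset_len, Fintype.card_fin]

/-- `dim B_k = 1` (the socle line, the all-ones exponent function) -/
theorem card_top_eq_one (k : ℕ) : Fintype.card {v : Fin k → Fin 2 // (∑ i, (v i : ℕ)) = k * 1} = 1 := by
  refine Fintype.card_eq_one_iff.mpr ⟨⟨fun _ => 1, by simp⟩, fun ⟨y, hy⟩ => Subtype.ext ?_⟩
  have h := card_filter_eq (j := 0) y (by simpa using hy); rw [Finset.card_eq_zero] at h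
  exact (eq_ind_filter y).trans (by rw [h]; funext l; simp)

/-- the unit row vector at `x^{𝟙_S}` is the indicator `χ_S` -/
theorem single_eq_ind {K : Type*} [Field K] {k j : ℕ} (S : Finset (Fin k)) (hs : (∑ l : Fin k, ((if l ∈ S then (0 : Fin 2) else 1 : Fin 2) : ℕ)) + j = k * 1) :
    (Pi.single (⟨fun l => if l ∈ S then (0 : Fin 2) else 1, hs⟩ : {v : Fin k → Fin 2 // (∑ i, (v i : ℕ)) + j = k * 1}) (1 : K) : _ → K) =
      fun w => if w.1 = (fun l => if l ∈ S then (0 : Fin 2) else 1) then (1 : K) else 0 := by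
  funext w
  by_cases hw : w.1 = (fun l => if l ∈ S then (0 : Fin 2) else 1)
  · rw [if_pos hw, Pi.single_apply, if_pos (Subtype.ext hw)]
  · rw [if_neg hw, Pi.single_apply, if_neg (fun h => hw (congrArg Subtype.val h))]

/-- three indices outside a small set -/
theorem exists_three_not_mem {k : ℕ} (S : Finset (Fin k)) (h : S.card + 3 ≤ k) : ∃ c d e : Fin k, c ∉ S ∧ d ∉ S ∧ e ∉ S ∧ c ≠ d ∧ c ≠ e ∧ d ≠ e := by
  have hcard : 2 < (Finset.univ \ S).card := by rw [Finset.card_univ_sdiff, Fintype.card_fin]; omega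
  obtain ⟨c, hc, d, hd, e, he, hcd, hce, hde⟩ := Finset.two_lt_card.mp hcard
  simp only [Finset.mem_sdiff, Finset.mem_univ, true_and] at hc hd he; exact ⟨c, d, e, hc, hd, he, hcd, hce, hde⟩

/-! ## The column lists `colR 3 (List.ofFn 𝟙_S)` -/

/-- every member of `colR 3 (ofFn m)` raises ONE zero exponent of `m` to `1` (list level: every member, not only the `ofFn`s) -/
theorem mem_colR_three_iff {k : ℕ} (m : Fin k → Fin 2) (x : List ℕ) :
    x ∈ colR 3 (List.ofFn fun l => (m l : ℕ)) ↔ ∃ i : Fin k, m i = 0 ∧ x = List.ofFn fun l => ((if l = i then (1 : Fin 2) else m l : Fin 2) : ℕ) := by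
  rw [mem_colR_iff]
  constructor
  · rintro ⟨i, hi, h0, rfl⟩; rw [List.length_ofFn] at hi
    refine ⟨⟨i, hi⟩, Fin.ext (by simpa using h0), List.ext_getElem (by simp) fun j h1 h2 => ?_⟩
    rw [List.length_set, List.length_ofFn] at h1; simp only [List.getElem_set, List.getElem_ofFn, Fin.ext_iff]
    by_cases hij : i = j
    · subst hij; simp
    · rw [if_neg hij, if_neg (Ne.symm hij)]
  · rintro ⟨i, h0, rfl⟩
    refine ⟨i, by simp, by simpa using congrArg Fin.val h0, List.ext_getElem (by simp) fun j h1 h2 => ?_⟩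
    rw [List.length_ofFn] at h1; simp only [List.getElem_set, List.getElem_ofFn, Fin.ext_iff]
    by_cases hij : (i : ℕ) = j
    · rw [if_pos hij, if_pos hij.symm]; simp
    · rw [if_neg hij, if_neg (Ne.symm hij)]

/-- `ℓ · x^{𝟙_S} = Σ_{i ∈ S} x^{𝟙_{S ∖ i}}`: the members of the column list of `𝟙_S` are the `𝟙_{S.erase i}`, `i ∈ S` -/
theorem mem_colR_ind_iff {k : ℕ} (S : Finset (Fin k)) (x : List ℕ) :
    x ∈ colR 3 (List.ofFn fun l => ((if l ∈ S then (0 : Fin 2) else 1 : Fin 2) : ℕ)) ↔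
      ∃ i ∈ S, x = List.ofFn fun l => ((if l ∈ S.erase i then (0 : Fin 2) else 1 : Fin 2) : ℕ) := by
  rw [mem_colR_three_iff]
  refine exists_congr fun i => ?_
  have e : (fun l => ((if l = i then (1 : Fin 2) else if l ∈ S then 0 else 1 : Fin 2) : ℕ)) = fun l => ((if l ∈ S.erase i then (0 : Fin 2) else 1 : Fin 2) : ℕ) := by
    funext l; by_cases hl : l = i <;> simp [hl, Finset.mem_erase]
  rw [e]
  simp

/-- the column list of `𝟙_{abc}`: the three pair indicators -/
theorem mem_colR_ind_three_iff {k : ℕ} (a b c : Fin k) (hab : a ≠ b) (hac : a ≠ c) (hbc : b ≠ c) (x : List ℕ) :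
    x ∈ colR 3 (List.ofFn fun l => ((if l ∈ ({a, b, c} : Finset (Fin k)) then (0 : Fin 2) else 1 : Fin 2) : ℕ)) ↔
      (x = List.ofFn fun l => ((if l ∈ ({b, c} : Finset (Fin k)) then (0 : Fin 2) else 1 : Fin 2) : ℕ)) ∨
      (x = List.ofFn fun l => ((if l ∈ ({a, c} : Finset (Fin k)) then (0 : Fin 2) else 1 : Fin 2) : ℕ)) ∨
      (x = List.ofFn fun l => ((if l ∈ ({a, b} : Finset (Fin k)) then (0 : Fin 2) else 1 : Fin 2) : ℕ)) := by
  rw [mem_colR_ind_iff]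
  have e1 : ({a, b, c} : Finset (Fin k)).erase a = {b, c} := by rw [Finset.erase_insert_eq_erase, Finset.erase_eq_of_notMem (by simp [hab, hac])]
  have e2 : ({a, b, c} : Finset (Fin k)).erase b = {a, c} := by
    rw [Finset.erase_insert_of_ne hab, Finset.erase_insert_eq_erase, Finset.erase_eq_of_notMem (by simp [hbc])]
  have e3 : ({a, b, c} : Finset (Fin k)).erase c = {a, b} := by
    rw [Finset.erase_insert_of_ne hac, Finset.erase_insert_of_ne hbc, Finset.erase_singleton]; rfl
  simp only [Finset.mem_insert, Finset.mem_singleton, or_and_right, exists_or, exists_eq_left, e1, e2, e3]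

/-- the column list of `𝟙_{ab}`: the two point indicators -/
theorem mem_colR_ind_two_iff {k : ℕ} (a b : Fin k) (hab : a ≠ b) (x : List ℕ) :
    x ∈ colR 3 (List.ofFn fun l => ((if l ∈ ({a, b} : Finset (Fin k)) then (0 : Fin 2) else 1 : Fin 2) : ℕ)) ↔
      (x = List.ofFn fun l => ((if l ∈ ({b} : Finset (Fin k)) then (0 : Fin 2) else 1 : Fin 2) : ℕ)) ∨
      (x = List.ofFn fun l => ((if l ∈ ({a} : Finset (Fin k)) then (0 : Fin 2) else 1 : Fin 2) : ℕ)) := by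
  rw [mem_colR_ind_iff]
  have e1 : ({a, b} : Finset (Fin k)).erase a = {b} := by rw [Finset.erase_insert_eq_erase, Finset.erase_eq_of_notMem (by simp [hab])]
  have e2 : ({a, b} : Finset (Fin k)).erase b = {a} := by rw [Finset.erase_insert_of_ne hab, Finset.erase_singleton]; rfl
  simp only [Finset.mem_insert, Finset.mem_singleton, or_and_right, exists_or, exists_eq_left, e1, e2]

/-- `List.ofFn` of the values is injective on exponent functions -/
theorem ofFn_val_inj {k : ℕ} (v w : Fin k → Fin 2) : (List.ofFn fun l => (v l : ℕ)) = (List.ofFn fun l => (w l : ℕ)) ↔ v = w := by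
  constructor
  · intro h; funext l; exact Fin.ext (congrFun (List.ofFn_injective h) l)
  · rintro rfl; rfl

/-- distinct zero sets give distinct indicators -/
theorem ind_ne {k : ℕ} (S T : Finset (Fin k)) (x : Fin k) (hS : x ∉ S) (hT : x ∈ T) :
    (fun l => if l ∈ S then (0 : Fin 2) else 1) ≠ fun l => if l ∈ T then (0 : Fin 2) else 1 := by
  intro h
  have := congrFun h x
  simp [hS, hT] at this

/-- COLUMN of `×ℓ` at the source `x^{𝟙_{abc}}`: `χ_{bc} + χ_{ac} + χ_{ab}` -/
theorem col_one_eq {K : Type*} [Field K] {k : ℕ} (a b c : Fin k) (hab : a ≠ b) (hac : a ≠ c) (hbc : b ≠ c) (w : Fin k → Fin 2) :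
    (if List.ofFn (fun l => (w l : ℕ)) ∈ colR 3 (List.ofFn fun l => ((if l ∈ ({a, b, c} : Finset (Fin k)) then (0 : Fin 2) else 1 : Fin 2) : ℕ)) then (1 : K) else 0) =
      (if w = (fun l => if l ∈ ({b, c} : Finset (Fin k)) then (0 : Fin 2) else 1) then (1 : K) else 0) +
      (if w = (fun l => if l ∈ ({a, c} : Finset (Fin k)) then (0 : Fin 2) else 1) then (1 : K) else 0) +
      (if w = (fun l => if l ∈ ({a, b} : Finset (Fin k)) then (0 : Fin 2) else 1) then (1 : K) else 0) := by
  simp only [mem_colR_ind_three_iff a b c hab hac hbc, ofFn_val_inj]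
  refine ite_or_three ?_ ?_ ?_
  · rintro ⟨rfl, h⟩; exact ind_ne _ _ a (by simp [hab, hac]) (by simp) h
  · rintro ⟨rfl, h⟩; exact ind_ne _ _ a (by simp [hab, hac]) (by simp) h
  · rintro ⟨rfl, h⟩; exact ind_ne _ _ b (by simp [Ne.symm hab, hbc]) (by simp) h

/-- COLUMN of `×ℓ²` at the source `x^{𝟙_{abc}}`: `2(χ_a + χ_b + χ_c)` -/
theorem col_two_eq {K : Type*} [Field K] {k : ℕ} (a b c : Fin k) (hab : a ≠ b) (hac : a ≠ c) (hbc : b ≠ c) (w : Fin k → Fin 2) :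
    ((((colR 3 (List.ofFn fun l => ((if l ∈ ({a, b, c} : Finset (Fin k)) then (0 : Fin 2) else 1 : Fin 2) : ℕ))).flatMap (colR 3)).count
        (List.ofFn fun l => (w l : ℕ)) : ℕ) : K) =
      (2 : K) • ((if w = (fun l => if l ∈ ({a} : Finset (Fin k)) then (0 : Fin 2) else 1) then (1 : K) else 0) +
      (if w = (fun l => if l ∈ ({b} : Finset (Fin k)) then (0 : Fin 2) else 1) then (1 : K) else 0) +
      (if w = (fun l => if l ∈ ({c} : Finset (Fin k)) then (0 : Fin 2) else 1) then (1 : K) else 0)) := by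
  -- `ℓ · x^{𝟙_{abc}}` lists (a permutation of) the three pair indicators
  have hperm : (colR 3 (List.ofFn fun l => ((if l ∈ ({a, b, c} : Finset (Fin k)) then (0 : Fin 2) else 1 : Fin 2) : ℕ))).Perm
      [List.ofFn fun l => ((if l ∈ ({b, c} : Finset (Fin k)) then (0 : Fin 2) else 1 : Fin 2) : ℕ),
       List.ofFn fun l => ((if l ∈ ({a, c} : Finset (Fin k)) then (0 : Fin 2) else 1 : Fin 2) : ℕ),
       List.ofFn fun l => ((if l ∈ ({a, b} : Finset (Fin k)) then (0 : Fin 2) else 1 : Fin 2) : ℕ)] := by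
    refine (List.perm_ext_iff_of_nodup (colR_nodup 3 le_rfl _) ?_).mpr fun x => ?_
    · refine List.nodup_cons.mpr ⟨?_, List.nodup_cons.mpr ⟨?_, List.nodup_singleton _⟩⟩
      · simp only [List.mem_cons, List.not_mem_nil, or_false, ofFn_val_inj, not_or]
        exact ⟨ind_ne _ _ a (by simp [hab, hac]) (by simp), ind_ne _ _ a (by simp [hab, hac]) (by simp)⟩
      · simp only [List.mem_cons, List.not_mem_nil, or_false, ofFn_val_inj]
        exact ind_ne _ _ b (by simp [Ne.symm hab, hbc]) (by simp)
    · rw [mem_colR_ind_three_iff a b c hab hac hbc]; simp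
  rw [(hperm.flatMap_right (colR 3)).count_eq]
  simp only [List.flatMap_cons, List.flatMap_nil, List.append_nil, List.count_append, Nat.cast_add]
  rw [← indicator_eq_count_colR K 3 le_rfl, ← indicator_eq_count_colR K 3 le_rfl, ← indicator_eq_count_colR K 3 le_rfl]
  simp only [mem_colR_ind_two_iff b c hbc, mem_colR_ind_two_iff a c hac, mem_colR_ind_two_iff a b hab, ofFn_val_inj]
  rw [ite_or_two (by rintro ⟨rfl, h⟩; exact ind_ne _ _ b (by simp [hbc]) (by simp) h), ite_or_two (by rintro ⟨rfl, h⟩; exact ind_ne _ _ a (by simp [hac]) (by simp) h),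
    ite_or_two (by rintro ⟨rfl, h⟩; exact ind_ne _ _ a (by simp [hab]) (by simp) h)]
  ring

/-- `ℓ³ · (x₄⋯x_k) = 6 · x₁⋯x_k`: the entry behind THEOREM (iii) (source zero set `{a,b,c}` = the first three indices) -/
theorem count_flatMap3 (j : ℕ) (a b c : Fin (j + 3)) (ha : (a : ℕ) = 0) (hb : (b : ℕ) = 1) (hc : (c : ℕ) = 2) :
    ((((colR 3 (List.ofFn fun l : Fin (j + 3) => ((if l ∈ ({a, b, c} : Finset (Fin (j + 3))) then (0 : Fin 2) else 1 : Fin 2) : ℕ))).flatMap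
        (colR 3)).flatMap (colR 3)).count (List.ofFn fun l : Fin (j + 3) => (((fun _ => 1 : Fin (j + 3) → Fin 2) l : Fin 2) : ℕ))) = 6 := by
  have hR : ∀ x ∈ List.replicate j 1, 1 ≤ x := fun x hx => by rw [List.eq_of_mem_replicate hx]
  have e1 : (List.ofFn fun l : Fin (j + 3) => ((if l ∈ ({a, b, c} : Finset (Fin (j + 3))) then (0 : Fin 2) else 1 : Fin 2) : ℕ)) =
      0 :: 0 :: 0 :: List.replicate j 1 := by
    rw [List.ofFn_succ, List.ofFn_succ, List.ofFn_succ]; simp [Fin.ext_iff, ha, hb, hc, List.ofFn_const]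
  have e2 : (List.ofFn fun l : Fin (j + 3) => (((fun _ => 1 : Fin (j + 3) → Fin 2) l : Fin 2) : ℕ)) = 1 :: 1 :: 1 :: List.replicate j 1 := by
    rw [List.ofFn_succ, List.ofFn_succ, List.ofFn_succ]; simp [List.ofFn_const]
  rw [e1, e2]; simp [colR, colR_pos 3 _ hR]

/-! ## THE `d = 3` CELLS OF THEOREM K-MODEL -/

/-- THEOREM (i), `k ≥ 5`.  If `(2 : K) ≠ 0` and `(3 : K) ≠ 0` then `×ℓ : B_{k−3} → B_{k−2}` is onto: the indicator matrix (rows `{v // Σ v_i + 2 = k}`, columns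
`{m // Σ m_i + 3 = k}`, entry `[ofFn v ∈ colR 3 (ofFn m)]`) has rank `card rows = C(k,2)` (`card_level`). -/
theorem rank_mulL_modelC1_d3 (K : Type*) [Field K] (h2 : (2 : K) ≠ 0) (h3 : (3 : K) ≠ 0) (k : ℕ) (hk : 5 ≤ k) :
    (Matrix.of fun (v : {v : Fin k → Fin 2 // (∑ i, (v i : ℕ)) + 2 = k * 1}) (m : {m : Fin k → Fin 2 // (∑ i, (m i : ℕ)) + 3 = k * 1}) =>
      if List.ofFn (fun i => (v.1 i : ℕ)) ∈ colR 3 (List.ofFn (fun i => (m.1 i : ℕ))) then (1 : K) else 0).rank =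
      Fintype.card {v : Fin k → Fin 2 // (∑ i, (v i : ℕ)) + 2 = k * 1} := by
  set A := (Matrix.of fun (v : {v : Fin k → Fin 2 // (∑ i, (v i : ℕ)) + 2 = k * 1}) (m : {m : Fin k → Fin 2 // (∑ i, (m i : ℕ)) + 3 = k * 1}) =>
      if List.ofFn (fun i => (v.1 i : ℕ)) ∈ colR 3 (List.ofFn (fun i => (m.1 i : ℕ))) then (1 : K) else 0) with hA
  -- the column at the source `x^{𝟙_{xyz}}` is `χ_{yz} + χ_{xz} + χ_{xy}`, a member of the column span
  have hmem : ∀ x y z : Fin k, x ≠ y → x ≠ z → y ≠ z →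
      ((fun w => if w.1 = (fun l => if l ∈ ({y, z} : Finset (Fin k)) then (0 : Fin 2) else 1) then (1 : K) else 0) +
        (fun w => if w.1 = (fun l => if l ∈ ({x, z} : Finset (Fin k)) then (0 : Fin 2) else 1) then (1 : K) else 0) +
        (fun w => if w.1 = (fun l => if l ∈ ({x, y} : Finset (Fin k)) then (0 : Fin 2) else 1) then (1 : K) else 0) :
        {v : Fin k → Fin 2 // (∑ i, (v i : ℕ)) + 2 = k * 1} → K) ∈ Submodule.span K (Set.range A.col) := by
    intro x y z hxy hxz hyz
    refine Submodule.subset_span ⟨⟨_, sum_ind_three x y z hxy hxz hyz⟩, funext fun w => ?_⟩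
    simp only [Pi.add_apply]; exact col_one_eq x y z hxy hxz hyz w.1
  apply rank_eq_card_of_single_mem_span_cols; rintro ⟨s, hs⟩
  obtain ⟨a, b, hab, rfl⟩ := row_shape_two s hs
  obtain ⟨c, d, e, hc, hd, he, hcd, hce, hde⟩ := exists_three_not_mem ({a, b} : Finset (Fin k)) (by rw [Finset.card_pair hab]; omega)
  simp only [Finset.mem_insert, Finset.mem_singleton, not_or] at hc hd he
  rw [single_eq_ind]
  exact mem_of_ten_triples h2 h3 _ (hmem a b c hab (Ne.symm hc.1) (Ne.symm hc.2)) (hmem a b d hab (Ne.symm hd.1) (Ne.symm hd.2))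
    (hmem a b e hab (Ne.symm he.1) (Ne.symm he.2)) (hmem a c d (Ne.symm hc.1) (Ne.symm hd.1) hcd) (hmem a c e (Ne.symm hc.1) (Ne.symm he.1) hce)
    (hmem a d e (Ne.symm hd.1) (Ne.symm he.1) hde) (hmem b c d (Ne.symm hc.2) (Ne.symm hd.2) hcd) (hmem b c e (Ne.symm hc.2) (Ne.symm he.2) hce)
    (hmem b d e (Ne.symm hd.2) (Ne.symm he.2) hde) (hmem c d e hcd hce hde)

/-- THEOREM (i), `k = 4`.  If `(2 : K) ≠ 0` then `×ℓ : B_1 → B_2` is into: the `6 × 4` indicator matrix has rank `card cols = 4` (a `4 × 4` minor has `det = 2`). -/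
theorem rank_mulL_modelC1_d3_four (K : Type*) [Field K] (h2 : (2 : K) ≠ 0) :
    (Matrix.of fun (v : {v : Fin 4 → Fin 2 // (∑ i, (v i : ℕ)) + 2 = 4 * 1}) (m : {m : Fin 4 → Fin 2 // (∑ i, (m i : ℕ)) + 3 = 4 * 1}) =>
      if List.ofFn (fun i => (v.1 i : ℕ)) ∈ colR 3 (List.ofFn (fun i => (m.1 i : ℕ))) then (1 : K) else 0).rank =
      Fintype.card {m : Fin 4 → Fin 2 // (∑ i, (m i : ℕ)) + 3 = 4 * 1} := by
  set A := (Matrix.of fun (v : {v : Fin 4 → Fin 2 // (∑ i, (v i : ℕ)) + 2 = 4 * 1}) (m : {m : Fin 4 → Fin 2 // (∑ i, (m i : ℕ)) + 3 = 4 * 1}) =>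
      if List.ofFn (fun i => (v.1 i : ℕ)) ∈ colR 3 (List.ofFn (fun i => (m.1 i : ℕ))) then (1 : K) else 0) with hA
  apply le_antisymm (Matrix.rank_le_card_width A); rw [card_level 4 3, show Nat.choose 4 3 = 4 by decide]
  let r : Fin 4 → {v : Fin 4 → Fin 2 // (∑ i, (v i : ℕ)) + 2 = 4 * 1} := ![⟨![1, 1, 0, 0], by decide⟩, ⟨![1, 0, 1, 0], by decide⟩, ⟨![1, 0, 0, 1], by decide⟩, ⟨![0, 1, 1, 0], by decide⟩]
  let c : Fin 4 → {m : Fin 4 → Fin 2 // (∑ i, (m i : ℕ)) + 3 = 4 * 1} := ![⟨![1, 0, 0, 0], by decide⟩, ⟨![0, 1, 0, 0], by decide⟩, ⟨![0, 0, 1, 0], by decide⟩, ⟨![0, 0, 0, 1], by decide⟩]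
  refine le_trans (by simp) (card_le_rank_of_det_ne_zero (ι := Fin 4) A r c ?_)
  have hM : A.submatrix r c = !![1, 1, 0, 0; 1, 0, 1, 0; 1, 0, 0, 1; 0, 1, 1, 0] := by
    ext i j; fin_cases i <;> fin_cases j <;> simp [hA, r, c] <;> decide
  have sa : Fin.succAbove (1 : Fin 4) (2 : Fin 3) = 3 := by decide
  rw [hM]; simp [Matrix.det_succ_row_zero, Fin.sum_univ_succ, sa]; norm_num
  exact h2

/-- THEOREM (i), `k = 3`.  Over every field `×ℓ : B_0 → B_1` is into: the `3 × 1` indicator matrix has rank `card cols = 1`. -/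
theorem rank_mulL_modelC1_d3_three (K : Type*) [Field K] :
    (Matrix.of fun (v : {v : Fin 3 → Fin 2 // (∑ i, (v i : ℕ)) + 2 = 3 * 1}) (m : {m : Fin 3 → Fin 2 // (∑ i, (m i : ℕ)) + 3 = 3 * 1}) =>
      if List.ofFn (fun i => (v.1 i : ℕ)) ∈ colR 3 (List.ofFn (fun i => (m.1 i : ℕ))) then (1 : K) else 0).rank =
      Fintype.card {m : Fin 3 → Fin 2 // (∑ i, (m i : ℕ)) + 3 = 3 * 1} := by
  apply le_antisymm (Matrix.rank_le_card_width _); rw [card_level 3 3, show Nat.choose 3 3 = 1 by decide]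
  refine le_trans (by simp) (card_le_rank_of_det_ne_zero (ι := Fin 1) _ (fun _ => ⟨![1, 0, 0], by decide⟩) (fun _ => ⟨![0, 0, 0], by decide⟩) ?_)
  rw [Matrix.det_unique, Matrix.submatrix_apply, Matrix.of_apply, if_pos (by decide)]
  exact one_ne_zero

/-- THEOREM (ii), `k ≥ 4`.  If `(2 : K) ≠ 0` and `(3 : K) ≠ 0` then `×ℓ² : B_{k−3} → B_{k−1}` is onto: the multiplicity matrix (rows `{v // Σ v_i + 1 = k}`,
columns `{m // Σ m_i + 3 = k}`, entry = multiplicity of `ofFn v` in `(colR 3 (ofFn m)).flatMap (colR 3)`) has rank `card rows = k`. -/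
theorem rank_mulL2_modelC1_d3 (K : Type*) [Field K] (h2 : (2 : K) ≠ 0) (h3 : (3 : K) ≠ 0) (k : ℕ) (hk : 4 ≤ k) :
    (Matrix.of fun (v : {v : Fin k → Fin 2 // (∑ i, (v i : ℕ)) + 1 = k * 1}) (m : {m : Fin k → Fin 2 // (∑ i, (m i : ℕ)) + 3 = k * 1}) =>
      ((((colR 3 (List.ofFn fun i => (m.1 i : ℕ))).flatMap (colR 3)).count (List.ofFn fun i => (v.1 i : ℕ)) : ℕ) : K)).rank =
      Fintype.card {v : Fin k → Fin 2 // (∑ i, (v i : ℕ)) + 1 = k * 1} := by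
  set A := (Matrix.of fun (v : {v : Fin k → Fin 2 // (∑ i, (v i : ℕ)) + 1 = k * 1}) (m : {m : Fin k → Fin 2 // (∑ i, (m i : ℕ)) + 3 = k * 1}) =>
      ((((colR 3 (List.ofFn fun i => (m.1 i : ℕ))).flatMap (colR 3)).count (List.ofFn fun i => (v.1 i : ℕ)) : ℕ) : K)) with hA
  -- the column at the source `x^{𝟙_{xyz}}` is `2(χ_x + χ_y + χ_z)`, a member of the column span
  have hmem : ∀ x y z : Fin k, x ≠ y → x ≠ z → y ≠ z →
      ((2 : K) • ((fun w => if w.1 = (fun l => if l ∈ ({x} : Finset (Fin k)) then (0 : Fin 2) else 1) then (1 : K) else 0) +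
        (fun w => if w.1 = (fun l => if l ∈ ({y} : Finset (Fin k)) then (0 : Fin 2) else 1) then (1 : K) else 0) +
        (fun w => if w.1 = (fun l => if l ∈ ({z} : Finset (Fin k)) then (0 : Fin 2) else 1) then (1 : K) else 0)) :
        {v : Fin k → Fin 2 // (∑ i, (v i : ℕ)) + 1 = k * 1} → K) ∈ Submodule.span K (Set.range A.col) := by
    intro x y z hxy hxz hyz
    refine Submodule.subset_span ⟨⟨_, sum_ind_three x y z hxy hxz hyz⟩, funext fun w => ?_⟩
    simp only [Pi.add_apply, Pi.smul_apply]; exact col_two_eq x y z hxy hxz hyz w.1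
  apply rank_eq_card_of_single_mem_span_cols; rintro ⟨s, hs⟩
  obtain ⟨d, rfl⟩ := row_shape_one s hs
  obtain ⟨a, b, c, ha, hb, hc, hab, hac, hbc⟩ := exists_three_not_mem ({d} : Finset (Fin k)) (by rw [Finset.card_singleton]; omega)
  simp only [Finset.mem_singleton] at ha hb hc
  rw [single_eq_ind]
  exact mem_of_four_triples h2 h3 _ (hmem a b c hab hac hbc) (hmem a b d hab ha hb) (hmem a c d hac ha hc) (hmem b c d hbc hb hc)

/-- THEOREM (ii), `k = 3`.  If `(2 : K) ≠ 0` then `×ℓ² : B_0 → B_2` is into: the `3 × 1` multiplicity matrix (all entries `2`) has rank `card cols = 1`. -/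
theorem rank_mulL2_modelC1_d3_three (K : Type*) [Field K] (h2 : (2 : K) ≠ 0) :
    (Matrix.of fun (v : {v : Fin 3 → Fin 2 // (∑ i, (v i : ℕ)) + 1 = 3 * 1}) (m : {m : Fin 3 → Fin 2 // (∑ i, (m i : ℕ)) + 3 = 3 * 1}) =>
      ((((colR 3 (List.ofFn fun i => (m.1 i : ℕ))).flatMap (colR 3)).count (List.ofFn fun i => (v.1 i : ℕ)) : ℕ) : K)).rank =
      Fintype.card {m : Fin 3 → Fin 2 // (∑ i, (m i : ℕ)) + 3 = 3 * 1} := by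
  apply le_antisymm (Matrix.rank_le_card_width _); rw [card_level 3 3, show Nat.choose 3 3 = 1 by decide]
  refine le_trans (by simp) (card_le_rank_of_det_ne_zero (ι := Fin 1) _ (fun _ => ⟨![0, 1, 1], by decide⟩) (fun _ => ⟨![0, 0, 0], by decide⟩) ?_)
  rw [Matrix.det_unique, Matrix.submatrix_apply, Matrix.of_apply]
  have hc : (((colR 3 (List.ofFn fun i => (((![0, 0, 0] : Fin 3 → Fin 2) i : Fin 2) : ℕ))).flatMap (colR 3)).count
      (List.ofFn fun i => (((![0, 1, 1] : Fin 3 → Fin 2) i : Fin 2) : ℕ)) : ℕ) = 2 := by decide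
  rw [hc]
  simpa using h2

/-- THEOREM (iii), `k ≥ 3`.  If `(2 : K) ≠ 0` and `(3 : K) ≠ 0` then `×ℓ³ : B_{k−3} → B_k` is onto the socle line: the multiplicity matrix (rows `{v // Σ v_i = k}`
— only the all-ones function, `card_top_eq_one` —, columns `{m // Σ m_i + 3 = k}`, entry = multiplicity of `ofFn v` in the triple `flatMap`) has rank `1 = dim B_k`:
the entry at the source `x₄⋯x_k` is `6 ≠ 0` (`count_flatMap3`). -/
theorem rank_mulL3_modelC1_d3 (K : Type*) [Field K] (h2 : (2 : K) ≠ 0) (h3 : (3 : K) ≠ 0) (k : ℕ) (hk : 3 ≤ k) :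
    (Matrix.of fun (v : {v : Fin k → Fin 2 // (∑ i, (v i : ℕ)) = k * 1}) (m : {m : Fin k → Fin 2 // (∑ i, (m i : ℕ)) + 3 = k * 1}) =>
      (((((colR 3 (List.ofFn fun i => (m.1 i : ℕ))).flatMap (colR 3)).flatMap (colR 3)).count (List.ofFn fun i => (v.1 i : ℕ)) : ℕ) : K)).rank = 1 := by
  obtain ⟨j, rfl⟩ : ∃ j, k = j + 3 := ⟨k - 3, by omega⟩
  apply le_antisymm ((Matrix.rank_le_card_height _).trans_eq (card_top_eq_one (j + 3)))
  -- the first three indices as opaque variables (re-elaborated `Fin` literals make the unifier time out)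
  obtain ⟨a, b, c, hab, hac, hbc, ha, hb, hc⟩ : ∃ a b c : Fin (j + 3), a ≠ b ∧ a ≠ c ∧ b ≠ c ∧ (a : ℕ) = 0 ∧ (b : ℕ) = 1 ∧ (c : ℕ) = 2 :=
    ⟨⟨0, by omega⟩, ⟨1, by omega⟩, ⟨2, by omega⟩, by simp, by simp, by simp, rfl, rfl, rfl⟩
  refine le_trans (by simp) (card_le_rank_of_det_ne_zero (ι := Fin 1) _ (fun _ => ⟨fun _ => 1, by simp⟩)
    (fun _ => ⟨fun l => if l ∈ ({a, b, c} : Finset (Fin (j + 3))) then 0 else 1, sum_ind_three a b c hab hac hbc⟩) ?_)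
  rw [Matrix.det_unique, Matrix.submatrix_apply, Matrix.of_apply, count_flatMap3 j a b c ha hb hc]
  simpa using six_ne_zero_of h2 h3

end Summit.HodgeConjecture.HodgeConjecture.HodgeLocus.Census.UnitColumnRankD3
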